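import Summits.HodgeConjecture.HodgeConjecture.Theses.TropicalWeilObstruction
import Summits.HodgeConjecture.HodgeConjecture.Theorems.TropicalWeilObstructionTropicalWeilVanishingClassPositivityCone
import Summits.HodgeConjecture.HodgeConjecture.Theorems.TropicalWeilObstructionTropicalWeilVanishingFlatCycles
import Summits.HodgeConjecture.HodgeConjecture.Theorems.TropicalWeilObstructionTropicalHodgeBoundThetaLine
import HarnessLib

/-!
# Route `TropicalWeilObstruction` (Kontsevich's tropical test — NEGATION SINK, exploration, no summit claim):
# an EFFECTIVE, calibrated tropical `4`-cycle on the boundary ray of the calibration cone (`Q = 1`)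

Negation-sink bookkeeping of the cell `pub-hodge-tropical` (seat tropical-2). The two halves landed by
the cell's two seats are put together:

* seat tropical-1's kernel certificate `Kappa.boundaryRay_eq_sum_frameSquares` (p337681): at the standard
  period, `24 · (8 · θ₄(1) + Re w(1)) = Σ_{j<206} n_j · p_{L_j} ⊗ p_{L_j}` with `n_j ∈ ℕ₊` and SATURATED
  integer frames `L_j` — the boundary ray `(q₀,q₁,q₂) = (8,1,0)` of the calibration cone
  `64 (q₁² + q₂²) ≤ q₀²` of p332805 is a positive combination of frame squares ("class positivity is
  exhausted by the cone", K1-SCOPE §4B (P));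
* this seat's constructor `FlatCycles.flatCycle` (p336634): any such combination is the CLASS OF AN
  EFFECTIVE tropical `4`-cycle on `ℝ⁸/ℤ⁸` — the weighted sum of the Kuhn-triangulated linear subtori through
  the `L_j` (`cyc_flatCycle`).

Result (`exists_calibrated_effective_cycle_on_cone_boundary`): **there is an effective tropical `4`-cycle
`Z` on the standard torus `ℝ⁸/ℤ⁸` (`206 × 24` cells) with `cyc Z = 24 · (8 · θ₄(1) + Re w(1))` — a class
IN K3's `3`-space, ON the boundary of the calibration cone, OFF the theta line — which is CALIBRATED:
`W(Z) = μ(Z) ≠ 0`, equality in the calibration inequality `‖W(Z)‖ ≤ μ(Z)` of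
`norm_weilFunctional_le_weilMass`.** So the inequality and the aperture `4^{1-n} = 1/64` of the cone are
sharp on the nose among effective tropical `4`-cycles (not merely among formal positive combinations of
frame squares), at the one period where such a cycle is in the tree. The second non-empty inhabitant of
`TropicalTorusCycle 8 4 1` after the refuter's `kuhnCycle` (p171405; `W = μ = 1`, class `e_{0123} ⊗ e_{0123}`
NOT in the `3`-space).

HONEST STATUS. `Q = 1` is NOT Weil-generic (`not_isWeilGeneric_one`): K1 (`TropicalWeilVanishing`,
stmt-18478) speaks about very general periods, where — K1 predicts — effective classes never leave the axis
`q₁ = q₂ = 0`; this file says nothing about that, nor about the Hodge conjecture. It records that positivity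
of the weights (all that `|W| ≤ μ` uses) is fully spent. No definition, no named fact, no sorry.
References: [Zharkov2020TropicalWeil] I. Zharkov, arXiv:2002.02347, §2; [MikhalkinZharkov2014Eigenwave]
G. Mikhalkin, I. Zharkov, LN UMI 15 (2014), Def. 4.2, Prop. 4.3.
-/

set_option linter.dupNamespace false

noncomputable section

open scoped BigOperators
open Matrix
open Literature.AlgebraicGeometry.Tropical
open Summit.HodgeConjecture.HodgeConjecture.Theorems.TropicalHodgeBound

namespace Summit.HodgeConjecture.HodgeConjecture.Theorems.TropicalWeilVanishing.FlatCycles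

/-! ## §0 Display-only notation (the K3 skeleton's local definitions, verbatim bodies; nothing is defined) -/

/-- The skeleton's `dzCoord n S`. -/
local notation3 (prettyPrint := false) "dz⟦" n "⟧" S:max =>
  (Matrix.det (Matrix.of fun k a : Fin n =>
    (if (S a : ℕ) = (k : ℕ) then (1 : ℂ) else 0) + (if (S a : ℕ) = (k : ℕ) + n then Complex.I else 0)))

/-- The skeleton's `weilPairing n C` (the value `Ŵ(C)` of `dz ⊗ dz`). -/
local notation3 (prettyPrint := false) "Ŵ⟦" n "⟧" C:max =>
  (∑ S : Fin n → Fin (2 * n), ∑ S' : Fin n → Fin (2 * n),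
    dz⟦n⟧ S * dz⟦n⟧ S' / ((Nat.factorial n : ℂ) ^ 2) * ((C S S' : ℝ) : ℂ))

/-- The hermitian pairing `M̂(C)` (the value of `dz ⊗ dz̄` on `C`), as in `…HermitianPairing`. -/
local notation3 (prettyPrint := false) "M̂⟦" n "⟧" C:max =>
  (∑ S : Fin n → Fin (2 * n), ∑ S' : Fin n → Fin (2 * n),
    dz⟦n⟧ S * (starRingEnd ℂ) (dz⟦n⟧ S') / ((Nat.factorial n : ℂ) ^ 2) * ((C S S' : ℝ) : ℂ))

/-- The skeleton's `thetaClass n Q`. -/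
local notation3 (prettyPrint := false) "θ⟦" n "⟧" Q:max =>
  (fun S S' : Fin n → Fin (2 * n) => Matrix.det (Matrix.submatrix Q S S'))

/-- The skeleton's `omegaFrame n` (`Ω = Pᴴ`). -/
local notation3 (prettyPrint := false) "Ω⟦" n "⟧" =>
  (Matrix.of fun (a : Fin (2 * n)) (b : Fin n) =>
    (if (a : ℕ) = (b : ℕ) then (1 : ℂ) else 0) - (if (a : ℕ) = (b : ℕ) + n then Complex.I else 0))

/-- The skeleton's `weilClassC n Q` (`w(Q) = (⋀ⁿQ ⊗ 1)(Ω ⊗ Ω)`). -/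
local notation3 (prettyPrint := false) "wC⟦" n "⟧" Q:max =>
  (fun S S' : Fin n → Fin (2 * n) =>
    Matrix.det (Matrix.submatrix (Matrix.map Q ((↑) : ℝ → ℂ) * Ω⟦n⟧) S id) *
      Matrix.det (Matrix.submatrix (Ω⟦n⟧) S' id))

/-- The skeleton's `weilClassRe n Q` (`w₁ = Re w`). -/
local notation3 (prettyPrint := false) "wRe⟦" n "⟧" Q:max =>
  (fun S S' : Fin n → Fin (2 * n) => Complex.re ((wC⟦n⟧ Q) S S'))

/-! ## §1 The calibrated boundary cycle -/

/-- `M̂` is homogeneous: `M̂(r • C) = r · M̂(C)`. [folklore] -/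
theorem hermPairing_smul (r : ℝ) (C : (Fin 4 → Fin (2 * 4)) → (Fin 4 → Fin (2 * 4)) → ℝ) :
    M̂⟦4⟧ (r • C) = (r : ℂ) * M̂⟦4⟧ C := by
  rw [Finset.mul_sum]
  refine Finset.sum_congr rfl fun S _ => ?_
  rw [Finset.mul_sum]
  refine Finset.sum_congr rfl fun S' _ => ?_
  simp only [Pi.smul_apply, smul_eq_mul, Complex.ofReal_mul]
  ring

/-- **An effective, calibrated tropical `4`-cycle on the boundary ray of the calibration cone.** On the
standard torus `ℝ⁸/ℤ⁸` (period `Q = 1`) there is an effective tropical `4`-cycle `Z` (certificate format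
`TropicalTorusCycle 8 4 1`) whose class is `cyc Z = 24 · (8 · θ₄(1) + Re w(1))` — coordinates
`(q₀, q₁, q₂) = (192, 24, 0)` in K3's `3`-space, `64 (q₁² + q₂²) = q₀²` — and which is CALIBRATED: its Weil
functional equals its mass, `W(Z) = μ(Z) = Σ_σ w_σ a_σ |η_σ|²`, and is non-zero. (`Z` = the weighted sum of
the `206` Kuhn-triangulated linear `4`-subtori through tropical-1's certified frames.)
[cite: Zharkov2020TropicalWeil, §2] [cite: MikhalkinZharkov2014Eigenwave, Def. 4.2, Prop. 4.3] -/
theorem exists_calibrated_effective_cycle_on_cone_boundary :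
    ∃ Z : TropicalTorusCycle (2 * 4) 4 (1 : Matrix (Fin (2 * 4)) (Fin (2 * 4)) ℝ),
      TropicalTorusCycle.cyc Z =
          (24 : ℝ) • ((8 : ℝ) • θ⟦4⟧ (1 : Matrix (Fin (2 * 4)) (Fin (2 * 4)) ℝ) +
            wRe⟦4⟧ (1 : Matrix (Fin (2 * 4)) (Fin (2 * 4)) ℝ)) ∧
      weilFunctional Z = ((∑ σ, ((Z.cell σ).weight : ℝ) * (Z.cell σ).latticeVolume *
          ‖frameComplexDet 4 (Z.cell σ).frame‖ ^ 2 : ℝ) : ℂ) ∧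
      weilFunctional Z ≠ 0 := by
  obtain ⟨w, L, hw, hL, hid⟩ := Kappa.boundaryRay_eq_sum_frameSquares
  choose M hM using hL
  refine ⟨flatCycle L M hM w hw, ?_, ?_, ?_⟩
  -- the class
  · funext S S'
    rw [cyc_flatCycle, hid]
    simp only [Finset.sum_apply, Pi.smul_apply, smul_eq_mul, Int.cast_mul]
  -- calibrated: `W = Ŵ(cyc Z) = 24 Ŵ(8θ + Re w) = 24 M̂(8θ + Re w) = M̂(cyc Z) = μ`
  · have hcyc : TropicalTorusCycle.cyc (flatCycle L M hM w hw) =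
        (24 : ℝ) • ((8 : ℝ) • θ⟦4⟧ (1 : Matrix (Fin (2 * 4)) (Fin (2 * 4)) ℝ) +
          wRe⟦4⟧ (1 : Matrix (Fin (2 * 4)) (Fin (2 * 4)) ℝ)) := by
      funext S S'
      rw [cyc_flatCycle, hid]
      simp only [Finset.sum_apply, Pi.smul_apply, smul_eq_mul, Int.cast_mul]
    rw [stub_weilFunctional_eq_pairing _ (flatCycle L M hM w hw), ← hermPairing_cyc _ (flatCycle L M hM w hw),
      hcyc, weilPairing_smul, hermPairing_smul, Kappa.weilPairing_boundaryRay_eq_hermPairing.1]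
  -- non-zero
  · have hcyc : TropicalTorusCycle.cyc (flatCycle L M hM w hw) =
        (24 : ℝ) • ((8 : ℝ) • θ⟦4⟧ (1 : Matrix (Fin (2 * 4)) (Fin (2 * 4)) ℝ) +
          wRe⟦4⟧ (1 : Matrix (Fin (2 * 4)) (Fin (2 * 4)) ℝ)) := by
      funext S S'
      rw [cyc_flatCycle, hid]
      simp only [Finset.sum_apply, Pi.smul_apply, smul_eq_mul, Int.cast_mul]
    rw [stub_weilFunctional_eq_pairing _ (flatCycle L M hM w hw), hcyc, weilPairing_smul]
    exact mul_ne_zero (by norm_num) Kappa.weilPairing_boundaryRay_eq_hermPairing.2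

/-- **The calibration inequality is sharp among effective cycles.** `‖W(Z)‖ = μ(Z)` for the cycle above:
equality in `norm_weilFunctional_le_weilMass` (p332805) is attained, at `Q = 1`, by an effective tropical
`4`-cycle whose class lies in the `3`-space `⟨θ₄, Re w, Im w⟩` on the boundary of the cone
`64 (q₁² + q₂²) ≤ q₀²`. [cite: Zharkov2020TropicalWeil, §2] -/
theorem exists_effective_cycle_norm_weilFunctional_eq_weilMass :
    ∃ Z : TropicalTorusCycle (2 * 4) 4 (1 : Matrix (Fin (2 * 4)) (Fin (2 * 4)) ℝ),
      TropicalTorusCycle.cyc Z =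
          (24 : ℝ) • ((8 : ℝ) • θ⟦4⟧ (1 : Matrix (Fin (2 * 4)) (Fin (2 * 4)) ℝ) +
            wRe⟦4⟧ (1 : Matrix (Fin (2 * 4)) (Fin (2 * 4)) ℝ)) ∧
      ‖weilFunctional Z‖ = ∑ σ, ((Z.cell σ).weight : ℝ) * (Z.cell σ).latticeVolume *
          ‖frameComplexDet 4 (Z.cell σ).frame‖ ^ 2 ∧
      0 < ‖weilFunctional Z‖ := by
  obtain ⟨Z, hc, hW, hne⟩ := exists_calibrated_effective_cycle_on_cone_boundary
  refine ⟨Z, hc, ?_, norm_pos_iff.mpr hne⟩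
  have hμ : 0 ≤ ∑ σ, ((Z.cell σ).weight : ℝ) * (Z.cell σ).latticeVolume *
      ‖frameComplexDet 4 (Z.cell σ).frame‖ ^ 2 :=
    Finset.sum_nonneg fun σ _ => mul_nonneg (mul_nonneg (Nat.cast_nonneg _)
      (TropicalWeilVanishing.latticeVolume_pos _).le) (sq_nonneg _)
  rw [hW, Complex.norm_real, Real.norm_of_nonneg hμ]

end Summit.HodgeConjecture.HodgeConjecture.Theorems.TropicalWeilVanishing.FlatCycles

end
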